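import Summits.BirchSwinnertonDyer.BirchSwinnertonDyer.Theorems.ManinLocalTwoThreeStevensIntegralityCES
import Summits.BirchSwinnertonDyer.BirchSwinnertonDyer.Theorems.ManinLocalTwoThreeIndexFourFullTwoTorsion
import Summits.BirchSwinnertonDyer.BirchSwinnertonDyer.Theorems.ManinLocalTwoThreeKummerValuesRationalTwoTorsion
import Summits.BirchSwinnertonDyer.BirchSwinnertonDyer.Theorems.ManinLocalTwoThreeStevensCuspRationalHolds
import Summits.BirchSwinnertonDyer.BirchSwinnertonDyer.Theorems.ManinLocalTwoThreeStevensCuspCyclotomic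
import HarnessLib

/-!
# Two cell rows PROVED by name now that CES is a theorem: E-es-185 `IndexFourForcesFreyTwistShape` and
# `CDivisionNeron.IndexFourForcesFullRationalTwoTorsion` (route `ManinLocalTwoThree`, crux C2 stmt-BirchSwinnertonDyer-22967;
# cell bsd-f2-manin, prover p2 gen 25; CES-discharge programme, stage 3 — row flips)

* `KummerDiamond.indexFourForcesFreyTwistShape_holds : IndexFourForcesFreyTwistShape` — E-es-185 (in the index-`4` configuration
  `Λ₁(f) = 2Λ₀(f)` at `4 ∣ N` the class has the Frey-twist shape), from the tree's `indexFourForcesFreyTwistShape_of_CES_Tes75flat` with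
  CES (`StevensIntegrality.exists_optimal_gamma1ParametrizationData_holds`) and T-es-75♭
  (`StevensGalois.optimalGamma1Parametrization_cuspInv_cyclotomic_galois_holds`) discharged;
* `CDivisionNeron.indexFourForcesFullRationalTwoTorsion_holds : IndexFourForcesFullRationalTwoTorsion` — the index-`4` configuration
  forces full rational `2`-torsion, from `indexFourForcesFullRationalTwoTorsion_of_cuspRational_CES` with F★
  (`CuspValues.optimalGamma1Parametrization_cusp_rational_holds`) and CES discharged.

Fact-free; standard axioms; no definitions.  C2, Manin's conjecture and BSD are not proved by this file.
[cite: Stevens1982, §1.3 Thm. 1.3.1] [cite: ConradEdixhovenStein2003, §6.1 Lemma 6.1.6] [cite: Stevens1989, §2]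
-/

set_option autoImplicit false
-- lint-debt: the directory name repeats the summit name (sibling precedent `ManinLocalTwoThreeStevensCurveDatum.lean`)
set_option linter.dupNamespace false

noncomputable section

open Literature.NumberTheory.EllipticCurves Literature.NumberTheory.EllipticCurves.ModularForms
open Summit.BirchSwinnertonDyer.BirchSwinnertonDyer.Theorems.ManinLocalTwoThree

namespace Summit.BirchSwinnertonDyer.Rank1Residual.ManinAdditive.KummerDiamond

/-- **E-es-185 `IndexFourForcesFreyTwistShape` HOLDS** (CES and T-es-75♭ are tree theorems). [cite: Stevens1982, §1.3 Thm. 1.3.1]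
[cite: ConradEdixhovenStein2003, §6.1 Lemma 6.1.6] -/
theorem indexFourForcesFreyTwistShape_holds : IndexFourForcesFreyTwistShape :=
  KummerValues.indexFourForcesFreyTwistShape_of_CES_Tes75flat StevensIntegrality.exists_optimal_gamma1ParametrizationData_holds
    StevensGalois.optimalGamma1Parametrization_cuspInv_cyclotomic_galois_holds

end Summit.BirchSwinnertonDyer.Rank1Residual.ManinAdditive.KummerDiamond

namespace Summit.BirchSwinnertonDyer.BirchSwinnertonDyer.Theorems.ManinLocalTwoThree.CDivisionNeron

/-- **`IndexFourForcesFullRationalTwoTorsion` HOLDS**: in the index-`4` configuration `Λ₁(f) = 2Λ₀(f)` at `4 ∣ N`, the lattice-optimal curve has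
full rational `2`-torsion (F★ and CES are tree theorems). [cite: ConradEdixhovenStein2003, §6.1.2, Lemma 6.1.6] [cite: Stevens1989, §2] -/
theorem indexFourForcesFullRationalTwoTorsion_holds : IndexFourForcesFullRationalTwoTorsion :=
  IndexFourTwoTorsion.indexFourForcesFullRationalTwoTorsion_of_cuspRational_CES CuspValues.optimalGamma1Parametrization_cusp_rational_holds
    StevensIntegrality.exists_optimal_gamma1ParametrizationData_holds

end Summit.BirchSwinnertonDyer.BirchSwinnertonDyer.Theorems.ManinLocalTwoThree.CDivisionNeron

end
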